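import Summits.QuantumFields.YangMills.Theorems.AllWindowsColdBoxBoxHighLineWickPairCubicForm
import Summits.QuantumFields.YangMills.Theorems.AllWindowsColdBoxBoxHighLineCum3TriangleBound

/-!
# `ConnectedThreePoint`, ODD part, COLD BOX: the centred `linCurvSq`-type form of a plaquette `q` against two colour-distinct cubic monomials on the
# edges of plaquettes at `x` and `y` has size `≤ β⁻⁴·C·(1+log H)⁴ / ((1+d(x,q))³(1+d(y,q))³(1+d(x,y))⁴)` (U5-BLOCKERS §2 L2 / ASSEMBLY-U5 §3, blocker B4)

Width seat `ym-line-sfw-p2-w3` (g41), cell ym-idea-1; U5 prep, helper-grade.  Fourth file of the odd part: the cold-box instance of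
✓`gauss_centredRankOne_mul_three_mul_three` (`…WickPairCubicForm`) with `g = (hodgeQ H)⁻¹`, `S = (2β)⁻¹·(g ⊗ 1)` (the chart propagator),
`D(i,i') = (2β)⁻¹^2·[κ_i=κ_{i'}]·(w ᵥ* g)(e_i)(w ᵥ* g)(e_{i'})`, `L = [κ=κ']·w⊗w`, and the line's kernel decays:

* `gaussAvg_centredRankOne_mul_three_mul_three` — the `gaussAvg β H` transcription (exact nine-block value);
* ★★ `abs_gaussAvg_centredLandauForm_mul_three_mul_three_le` — for `w = landauCoeff H q` and monomial legs on the edges of the plaquettes `(x,μ,ν)`,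
  `(y,μ',ν')` (colours distinct inside each monomial):
  `|gaussAvg β H ((Σ_{bb'} L_{bb'}(a_ba_{b'} − S_{bb'}))·a_{l₀}a_{l₁}a_{l₂}·a_{m₀}a_{m₁}a_{m₂})| ≤ β⁻¹^4 · C·(1+log H)^4 / ((1+d(x,q.1))^3·(1+d(y,q.1))^3·(1+d(x,y))^4)`
  (two GRADIENT lines ✓`RestBlock.landauKernelGradDecay` from `q` into the two monomials — legs within sup-distance 1 of the plaquette sites,
  ✓`EdgeChartGaussian.plaqEdge_fst_sub_le` — and two cross propagators ✓`EdgeChartGaussian.cross_propagator_le`, through ✓`abs_nineBlocks_le`).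
With `Σ_{bb'} L_{bb'}(a_ba_{b'} − S_{bb'}) = linCurvSq_q − E₀ linCurvSq_q` (✓`Cum3Triangle.linCurvSq_eq_quadVal`; `S` is the Gaussian two-point function) this is the
per-monomial-pair size of the odd×odd part of `f′(0)`; the expansion coefficients (✓`tripleForm_plaqVar_expansion`, `Σ|cA| ≤ 384·C₇`), the factor `β` of `V₃` and the
`p'`-sum (crude (3→2, 4) two-centre sum over plaquettes) are the assembler's: RELATIVE `≲ H³·polylog/β` (3θ < 1) in place of B4's sup bound (11θ < 1).

Tree only; no definitions; standard axioms.  HONEST LABEL: a tool for the RECORDED lift L2 of the NEXT rung U5 (⟨stmt-QuantumFields-24336⟩, UNSTAFFED); ⟨24004⟩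
⟨24336⟩ remain OPEN; route AllWindowsColdBox is DRAFT; no crux, rung or summit is proved; **the Yang–Mills mass gap is NOT proved by this file; no summit is
proved by a line.**
-/

set_option autoImplicit false

noncomputable section

open MeasureTheory Matrix Finset
open scoped Kronecker
open Literature.Probability.LatticeModels (Site)
open Literature.MathematicalPhysics.QuantumFieldTheory (Plaq)

namespace Summit.QuantumFields.YangMills.Theorems.AllWindowsColdBoxBoxHighLine

namespace WickPairCubic

open QuadFluct (boxQuadForm_eq_flat)
open LaplaceSandwich (flatten flatten_apply)

variable {H : ℕ}

/-- **Cold-box transcription of the nine-block formula** (`gaussAvg β H` letters; `g = (hodgeQ H)⁻¹`). -/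
theorem gaussAvg_centredRankOne_mul_three_mul_three {β : ℝ} (hβ : 0 < β) (w : LandauFree H → ℝ)
    (S D L : LandauFree H × Fin 3 → LandauFree H × Fin 3 → ℝ)
    (hS : ∀ i j, S i j = (2 * β)⁻¹ * if i.2 = j.2 then (hodgeQ H)⁻¹ i.1 j.1 else 0)
    (hD : ∀ i j, D i j = (2 * β)⁻¹ ^ 2 * if i.2 = j.2 then (w ᵥ* (hodgeQ H)⁻¹) i.1 * (w ᵥ* (hodgeQ H)⁻¹) j.1 else 0)
    (hL : ∀ i j, L i j = if i.2 = j.2 then w i.1 * w j.1 else 0) (l₀ l₁ l₂ m₀ m₁ m₂ : LandauFree H × Fin 3)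
    (h01 : l₀.2 ≠ l₁.2) (h02 : l₀.2 ≠ l₂.2) (h12 : l₁.2 ≠ l₂.2) (h01' : m₀.2 ≠ m₁.2) (h02' : m₀.2 ≠ m₂.2) (h12' : m₁.2 ≠ m₂.2) :
    gaussAvg β H (fun a => (∑ b, ∑ b', L b b' * (a b.1 b.2 * a b'.1 b'.2 - S b b')) *
        (a l₀.1 l₀.2 * a l₁.1 l₁.2 * a l₂.1 l₂.2) * (a m₀.1 m₀.2 * a m₁.1 m₁.2 * a m₂.1 m₂.2)) =
      2 * D l₀ m₀ * (S l₁ m₁ * S l₂ m₂ + S l₁ m₂ * S l₂ m₁) +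
        2 * D l₀ m₁ * (S l₁ m₀ * S l₂ m₂ + S l₁ m₂ * S l₂ m₀) +
        2 * D l₀ m₂ * (S l₁ m₀ * S l₂ m₁ + S l₁ m₁ * S l₂ m₀) +
        2 * D l₁ m₀ * (S l₀ m₁ * S l₂ m₂ + S l₀ m₂ * S l₂ m₁) +
        2 * D l₁ m₁ * (S l₀ m₀ * S l₂ m₂ + S l₀ m₂ * S l₂ m₀) +
        2 * D l₁ m₂ * (S l₀ m₀ * S l₂ m₁ + S l₀ m₁ * S l₂ m₀) +
        2 * D l₂ m₀ * (S l₀ m₁ * S l₁ m₂ + S l₀ m₂ * S l₁ m₁) +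
        2 * D l₂ m₁ * (S l₀ m₀ * S l₁ m₂ + S l₀ m₂ * S l₁ m₀) +
        2 * D l₂ m₂ * (S l₀ m₀ * S l₁ m₁ + S l₀ m₁ * S l₁ m₀) := by
  set Pm : Matrix (LandauFree H × Fin 3) (LandauFree H × Fin 3) ℝ := hodgeQ H ⊗ₖ (1 : Matrix (Fin 3) (Fin 3) ℝ) with hPdef
  have hP : Pm.PosDef := GaussianChartWick.posDef_kronecker_one _ (hodgeQ_posDef H)
  have hSP : ∀ i j, S i j = (2 * β)⁻¹ * Pm⁻¹ i j := fun i j => by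
    rw [hS, hPdef, EdgeChartGaussian.kronecker_one_inv_apply (hodgeQ H) (hodgeQ_posDef H).det_pos.ne']
  have h0 := integral_flat_mul_gaussWeight β H (fun _ => 1)
  simp only [one_mul] at h0
  have h8 : ∫ a : LandauFree H → E3, (fun a : LandauFree H → E3 => (∑ b, ∑ b', L b b' * (a b.1 b.2 * a b'.1 b'.2 - S b b')) *
        (a l₀.1 l₀.2 * a l₁.1 l₁.2 * a l₂.1 l₂.2) * (a m₀.1 m₀.2 * a m₁.1 m₁.2 * a m₂.1 m₂.2)) a * gaussWeight β H a =
      ∫ v : LandauFree H × Fin 3 → ℝ, (∑ b, ∑ b', L b b' * (v b * v b' - S b b')) * (v l₀ * v l₁ * v l₂) * (v m₀ * v m₁ * v m₂) *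
        Real.exp (-(β * (v ⬝ᵥ (Pm *ᵥ v)))) := by
    refine Eq.trans (integral_congr_ae (Filter.Eventually.of_forall fun a => ?_))
      (integral_flat_mul_gaussWeight β H (fun v => (∑ b, ∑ b', L b b' * (v b * v b' - S b b')) * (v l₀ * v l₁ * v l₂) * (v m₀ * v m₁ * v m₂)))
    simp only [flatten_apply_pair]
  unfold gaussAvg
  rw [h8, h0]
  exact gauss_centredRankOne_mul_three_mul_three Pm hP hβ ((hodgeQ H)⁻¹) w S D L hSP hS hD hL l₀ l₁ l₂ m₀ m₁ m₂ h01 h02 h12 h01' h02' h12'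

/-- An edge of the plaquette based at `x`: `(1 + d(x, z))⁻³ ≤ 8·(1 + d(base e, z))⁻³`-type comparison, here as `A/(1+d(base,z))³ ≤ 8A/(1+d(x,z))³`. -/
theorem div_pow_three_edge_le {e : LandauFree H} {x : Site 4} {μ ν : Fin 4} {i : Fin 4}
    (he : (e.1.1 : Literature.MathematicalPhysics.QuantumLattice.ZdEdge 4) = plaqEdge x μ ν i) {A : ℝ} (hA : 0 ≤ A) (z : Site 4) :
    A / (1 + siteDist e.1.1.1 z) ^ 3 ≤ 8 * A / (1 + siteDist x z) ^ 3 := by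
  have hx : ∀ k, |((e.1.1.1 k - x k : ℤ) : ℝ)| ≤ 1 := fun k => by rw [he]; exact EdgeChartGaussian.plaqEdge_fst_sub_le x μ ν i k
  have h1 : siteDist e.1.1.1 x ≤ 1 := CubeTwoCentre.siteDist_le_of_forall _ _ hx
  have h2 : siteDist x z ≤ siteDist e.1.1.1 x + siteDist e.1.1.1 z := CubeTwoCentre.siteDist_triangle e.1.1.1 x z
  have hd0 := GhostKernel.siteDist_nonneg e.1.1.1 z
  have hdx := GhostKernel.siteDist_nonneg x z
  have h3 : 1 + siteDist x z ≤ 2 * (1 + siteDist e.1.1.1 z) := by linarith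
  rw [div_le_div_iff₀ (by positivity) (by positivity)]
  calc A * (1 + siteDist x z) ^ 3 ≤ A * (2 * (1 + siteDist e.1.1.1 z)) ^ 3 := by gcongr
    _ = 8 * A * (1 + siteDist e.1.1.1 z) ^ 3 := by ring

/-- ★★ **Size of the odd three-point block, cold box.**  For `H ≥ 1`, `β > 0`, a plaquette `q` (the centred `linCurvSq`-type form of `w = landauCoeff H q`)
and two colour-distinct cubic monomials with legs on the edges of the plaquettes `(x,μ,ν)` and `(y,μ',ν')`:
`|gaussAvg(...)| ≤ β⁻¹^4·C·(1+log H)^4/((1+d(x,q.1))³(1+d(y,q.1))³(1+d(x,y))⁴)`. -/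
theorem abs_gaussAvg_centredLandauForm_mul_three_mul_three_le : ∃ C : ℝ, 0 ≤ C ∧ ∀ H : ℕ, 1 ≤ H → ∀ β : ℝ, 0 < β →
    ∀ (q : Plaq 4) (S L : LandauFree H × Fin 3 → LandauFree H × Fin 3 → ℝ),
    (∀ i j, S i j = (2 * β)⁻¹ * if i.2 = j.2 then (hodgeQ H)⁻¹ i.1 j.1 else 0) →
    (∀ i j, L i j = if i.2 = j.2 then landauCoeff H q i.1 * landauCoeff H q j.1 else 0) →
    ∀ (x y : Site 4) (μ ν μ' ν' : Fin 4) (l₀ l₁ l₂ m₀ m₁ m₂ : LandauFree H × Fin 3),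
    l₀.2 ≠ l₁.2 → l₀.2 ≠ l₂.2 → l₁.2 ≠ l₂.2 → m₀.2 ≠ m₁.2 → m₀.2 ≠ m₂.2 → m₁.2 ≠ m₂.2 →
    (∀ s : Fin 3, ∃ i : Fin 4, ((![l₀, l₁, l₂] s).1.1.1 : Literature.MathematicalPhysics.QuantumLattice.ZdEdge 4) = plaqEdge x μ ν i) →
    (∀ s : Fin 3, ∃ i : Fin 4, ((![m₀, m₁, m₂] s).1.1.1 : Literature.MathematicalPhysics.QuantumLattice.ZdEdge 4) = plaqEdge y μ' ν' i) →
    |gaussAvg β H (fun a => (∑ b, ∑ b', L b b' * (a b.1 b.2 * a b'.1 b'.2 - S b b')) *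
        (a l₀.1 l₀.2 * a l₁.1 l₁.2 * a l₂.1 l₂.2) * (a m₀.1 m₀.2 * a m₁.1 m₁.2 * a m₂.1 m₂.2))| ≤
      β⁻¹ ^ 4 * (C * (1 + Real.log H) ^ 4 / ((1 + siteDist x q.1) ^ 3 * (1 + siteDist y q.1) ^ 3 * (1 + siteDist x y) ^ 4)) := by
  obtain ⟨CD₀, hDk⟩ := RestBlock.landauKernelGradDecay
  obtain ⟨CS, hCS0, hSk⟩ := EdgeChartGaussian.cross_propagator_le
  set CD : ℝ := max CD₀ 0 with hCDdef
  have hCD : 0 ≤ CD := le_max_right _ _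
  refine ⟨36 * (64 * CD ^ 2) * (81 * CS ^ 2) / 16, by positivity, ?_⟩
  intro H hH β hβ q S L hS hL x y μ ν μ' ν' l₀ l₁ l₂ m₀ m₁ m₂ h01 h02 h12 h01' h02' h12' hlx hmy
  have hH' : (1 : ℝ) ≤ H := by exact_mod_cast hH
  set Lg : ℝ := 1 + Real.log H with hLg
  have hLg0 : 0 ≤ Lg := by have := Real.log_nonneg hH'; linarith
  set g : Matrix (LandauFree H) (LandauFree H) ℝ := (hodgeQ H)⁻¹ with hg
  set w : LandauFree H → ℝ := landauCoeff H q with hw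
  set D : LandauFree H × Fin 3 → LandauFree H × Fin 3 → ℝ := fun i j =>
    (2 * β)⁻¹ ^ 2 * if i.2 = j.2 then (w ᵥ* g) i.1 * (w ᵥ* g) j.1 else 0 with hDdef
  rw [gaussAvg_centredRankOne_mul_three_mul_three hβ w S D L hS (fun i j => rfl) hL l₀ l₁ l₂ m₀ m₁ m₂ h01 h02 h12 h01' h02' h12']
  -- the gradient lines
  have hgrad : ∀ (e : LandauFree H) (z : Site 4) (μ₀ ν₀ : Fin 4) (i : Fin 4),
      (e.1.1 : Literature.MathematicalPhysics.QuantumLattice.ZdEdge 4) = plaqEdge z μ₀ ν₀ i →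
      |(w ᵥ* g) e| ≤ 8 * (CD * Lg) / (1 + siteDist z q.1) ^ 3 := by
    intro e z μ₀ ν₀ i he
    rw [Cum3Triangle.vecMul_hodgeQ_inv]
    have h1 := hDk H hH e q
    calc |(g *ᵥ landauCoeff H q) e| ≤ CD₀ * Lg / (1 + (((∑ m : Fin 4, |e.1.1.1 m - q.1 m|) : ℤ) : ℝ)) ^ 3 := h1
      _ ≤ CD * Lg / (1 + (((∑ m : Fin 4, |e.1.1.1 m - q.1 m|) : ℤ) : ℝ)) ^ 3 :=
          div_le_div_of_nonneg_right (mul_le_mul_of_nonneg_right (le_max_left _ _) hLg0) (by positivity)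
      _ ≤ CD * Lg / (1 + siteDist e.1.1.1 q.1) ^ 3 := EdgeSums.div_l1_pow_le (by positivity) _ _ 3
      _ ≤ 8 * (CD * Lg) / (1 + siteDist z q.1) ^ 3 := div_pow_three_edge_le he (by positivity) q.1
  -- the two hypotheses of `abs_nineBlocks_le`
  have hDm : ∀ i j : Fin 3, |D (![l₀, l₁, l₂] i) (![m₀, m₁, m₂] j)| ≤
      (2 * β)⁻¹ ^ 2 * ((8 * (CD * Lg) / (1 + siteDist x q.1) ^ 3) * (8 * (CD * Lg) / (1 + siteDist y q.1) ^ 3)) := by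
    intro i j
    obtain ⟨i₀, hi₀⟩ := hlx i
    obtain ⟨j₀, hj₀⟩ := hmy j
    have ha := hgrad _ x μ ν i₀ hi₀
    have hb := hgrad _ y μ' ν' j₀ hj₀
    have hβ2 : 0 ≤ (2 * β)⁻¹ ^ 2 := by positivity
    simp only [hDdef]
    rw [abs_mul, abs_of_nonneg hβ2]
    refine mul_le_mul_of_nonneg_left ?_ hβ2
    split_ifs
    · rw [abs_mul]; exact mul_le_mul ha hb (abs_nonneg _) ((abs_nonneg _).trans ha)
    · rw [abs_zero]; exact mul_nonneg ((abs_nonneg _).trans ha) ((abs_nonneg _).trans hb)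
  have hWm : ∀ i j : Fin 3, |S (![l₀, l₁, l₂] i) (![m₀, m₁, m₂] j)| ≤ (2 * β)⁻¹ * (9 * CS * Lg / (1 + siteDist y x) ^ 2) := by
    intro i j
    obtain ⟨i₀, hi₀⟩ := hlx i
    obtain ⟨j₀, hj₀⟩ := hmy j
    rw [hS]
    exact hSk H hH β hβ x y μ ν μ' ν' _ _ i₀ j₀ hi₀ hj₀ _ _
  refine (abs_nineBlocks_le S D l₀ l₁ l₂ m₀ m₁ m₂ hDm hWm).trans (le_of_eq ?_)
  rw [EdgeChartGaussian.siteDist_comm y x]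
  have h1 : (1 + siteDist x q.1) ^ 3 ≠ 0 := by have := GhostKernel.siteDist_nonneg x q.1; positivity
  have h2 : (1 + siteDist y q.1) ^ 3 ≠ 0 := by have := GhostKernel.siteDist_nonneg y q.1; positivity
  have h3 : (1 + siteDist x y) ^ 2 ≠ 0 := by have := GhostKernel.siteDist_nonneg x y; positivity
  have hβ0 : β ≠ 0 := hβ.ne'
  field_simp
  ring

end WickPairCubic

end Summit.QuantumFields.YangMills.Theorems.AllWindowsColdBoxBoxHighLine

end
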